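import Literature.AnabelianGeometry.SemiGraphs.ThetaRayCritical
import Literature.AnabelianGeometry.SemiGraphs.ThetaRayEscapeCoincidence
import Literature.AnabelianGeometry.SemiGraphs.ThetaRayGraphFreeProP
import Literature.AnabelianGeometry.SemiGraphs.ThetaRayFreeProP
import Literature.AnabelianGeometry.SemiGraphs.ThetaRayFreeProPQuasiCoherent
import Literature.AnabelianGeometry.SemiGraphs.FreeProPRankTwoLevels
import Literature.AnabelianGeometry.SemiGraphs.TemperedLevelKernelCharOpenCore
import Literature.AnabelianGeometry.SemiGraphs.ThetaRayEscapeMaximalCompactFree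
import HarnessLib

/-!
# `¬ MaximalCompactIffVerticial`: the ∀-countable reading of [SemiAnbd] Thm 3.7 (iv) fails at `𝒢_θ` (REFUTE-F1732, (iv) row)

Mochizuki, *Semi-graphs of anabelioids*, Publ. RIMS **42** (2006) [MochizukiSemiAnbd2006], §3,
Theorem 3.7 (iv), author's manuscript p. 41 ("the maximal compact subgroups of `π₁^temp(𝒢)` are precisely
the verticial subgroups; the nontrivial intersections of two distinct maximal compact subgroups are
precisely the edge-like subgroups of closed edges"), hypotheses p. 40 as amended by [IUTchI] Rmk 2.5.3
(i)/(E7) [cite: MochizukiSemiAnbd2006, Thm 3.7(iv) p.41].  As for (iii) (abc-iut-L3-d4's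
`ThetaRayRefutation.lean`, `ProfiniteSemiGraph.not_compactInVerticial`), the printed proof concerns FINITE
underlying semi-graphs, where (iv) is a kernel theorem of the cell
(`maximalCompactIffVerticialAt_of_compactInVerticialAt` ∘ `compactInVerticialAt_of_finiteGraph`); the cell's
named fact `MaximalCompactIffVerticial` (F-1750) typed it for ALL countable semi-graphs of anabelioids.
THIS FILE REFUTES THAT ∀-COUNTABLE READING IN THE KERNEL, over EXACTLY the data of the (iii) refutation:

* `thetaRay_not_maximalCompactIffVerticialAt_of_hcrit` / `…_of_characters` — the (iv) twins of
  abc-iut-L3-t11's `thetaRay_not_compactInVerticialAt_of_hcrit` (p439805) and abc-iut-L3-d4's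
  `thetaRay_not_compactInVerticialAt_of_characters` (p441714), SAME binder blocks, closer :=
  `thetaRay_not_maximalCompactIffVerticialAt_of_levelEscape'` (p440846: the escaping compact `C` lies in a
  MAXIMAL compact subgroup by Zorn on compact subgroups of the tempered group — p435105/p438140, with the
  finite-subgroup bound `hbd_galoisLevelData` of abc-iut-L3-t6, p440571 — and a maximal compact subgroup
  containing `C` is not verticial);
* `ProfiniteSemiGraph.thetaRayFreeProP_not_maximalCompactIffVerticialAt (p) (n) (hn : ∀ k, k ≤ n k)` — at
  abc-iut-L3-d1's countermodel `𝒢_θ(p, n)` (abc-iut-L3-d4's model script of `ThetaRayRefutation.lean`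
  VERBATIM, with the (iv) closer);
* `ProfiniteSemiGraph.not_maximalCompactIffVerticial : ¬ MaximalCompactIffVerticial.{0}` (`p = 2`,
  `n k = k + 1`).

FRONTIER programme REFUTE-F1732 (plan/L3/SUBDAG-SemiAnbd-Thm37iii-REFUTE.md; bricks and credits as in
`ThetaRayRefutation.lean`; (iv)-Zorn thread abc-iut-w6-d120: p435105 p436156 p436980 p438140 p440637
p440846).  PROOF-ONLY file (0 definitions, no named fact, no hypothesis beyond `Fact p.Prime`).
HONEST FRAMING: an ERRATUM-GRADE result about the ∀-countable TYPING of a published statement whose printed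
proof (and every use in [IUTchI–IV]) concerns finite semi-graphs, where the statement is a kernel THEOREM; it
refutes nothing in the IUT corpus and bears in no way on [IUTchIII] Cor. 3.12.
-/

noncomputable section

namespace Literature.AnabelianGeometry.SemiGraphs

open CategoryTheory Topology Multiplicative
open ProfiniteSemiGraph ProfiniteSemiGraph.GaloisLevelData

/-! ### Generic ray of groups: the (iv) twins of the (iii) closers -/

section Generic

variable {G E : Type} [Group G] [TopologicalSpace G] [IsTopologicalGroup G] [CompactSpace G]
  [TotallyDisconnectedSpace G] [Group E] [TopologicalSpace E] [IsTopologicalGroup E] [CompactSpace E]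
  [TotallyDisconnectedSpace E] {up : E →ₜ* G} {low : ℕ → (E →ₜ* G)}
  {A V : ℕ → Type} [∀ n, CommGroup (A n)] [∀ n, TopologicalSpace (A n)] [∀ n, DiscreteTopology (A n)]
  [∀ n, Finite (A n)] [∀ n, CommGroup (V n)]

/-- **`¬ MaximalCompactIffVerticialAt (thetaRay G E up low)` modulo (hcoin), (hcrit)** — the (iv) twin of
abc-iut-L3-t11's `thetaRay_not_compactInVerticialAt_of_hcrit`, same binders: the level data (hz), (hfin),
(hfar) of the edge generators `z_k` of the base apartment come from `thetaRay_levelEscape_data`, and the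
escaping compact they generate lies in a maximal compact subgroup which is not verticial
(`thetaRay_not_maximalCompactIffVerticialAt_of_levelEscape'`). [cite: MochizukiSemiAnbd2006, Thm 3.7(iv) p.41] -/
theorem thetaRay_not_maximalCompactIffVerticialAt_of_hcrit (h37 : (thetaRay G E up low).Thm37Hypotheses)
    (P₀ : ((thetaRay G E up low).galoisLevelData h37.toProp36Hypotheses).PointSeq h37.isCountable (0 : ℕ))
    (e₀ : E)
    (hcoin : ∀ d : ℕ, ∃ N : ℕ, ∀ k, N ≤ k → (low (k + 1) e₀)⁻¹ * up e₀ ∈ charOpenCore G d)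
    (hcrit : let D := (thetaRay G E up low).galoisLevelData h37.toProp36Hypotheses
      let z : ℕ → D.temperedPi h37.isCountable := fun k =>
        (rayPointSeq (D := D) thetaRay_ham thetaRay_hap thetaRay_hmp P₀ (k + 1)).decompHom
          ((thetaRay G E up low).brHom (k, true) (k + 1) (thetaRay_hap k) e₀)
      ∀ n : ℕ, ∃ j₀ : ℕ, ∀ j, j₀ ≤ j → ∃ N : ℕ, ∀ k, N ≤ k →
        ∀ (y : (D.tree j).Vertex) (b b' : (D.tree j).Branch),
          (D.tree j).abuts b = some y → (D.tree j).abuts b' = some y →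
          (D.treeProj j).vertexMap y = n + 1 →
          (D.treeAct h37.isCountable j (z k)).hom.edgeMap ((D.tree j).edgeOf b) = (D.tree j).edgeOf b →
          (D.treeAct h37.isCountable j (z k)).hom.edgeMap ((D.tree j).edgeOf b') = (D.tree j).edgeOf b' →
          (∃ (b₂ : (D.tree j).Branch) (v₂ : (D.tree j).Vertex), b₂ ≠ b ∧
            (D.tree j).edgeOf b₂ = (D.tree j).edgeOf b ∧ (D.tree j).abuts b₂ = some v₂ ∧
            (D.treeProj j).vertexMap v₂ = n + 2) →
          (∃ (b₂ : (D.tree j).Branch) (v₂ : (D.tree j).Vertex), b₂ ≠ b' ∧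
            (D.tree j).edgeOf b₂ = (D.tree j).edgeOf b' ∧ (D.tree j).abuts b₂ = some v₂ ∧
            (D.treeProj j).vertexMap v₂ = n) →
          False) :
    ¬ MaximalCompactIffVerticialAt (thetaRay G E up low) := by
  obtain ⟨hz, hfin, hfar⟩ := thetaRay_levelEscape_data h37.toProp36Hypotheses P₀ e₀ hcoin
  exact thetaRay_not_maximalCompactIffVerticialAt_of_levelEscape' h37 _ hz hfin hfar hcrit

/-- **`¬ MaximalCompactIffVerticialAt (thetaRay G E up low)` from level data** — the (iv) twin of
abc-iut-L3-d4's `thetaRay_not_compactInVerticialAt_of_characters`, same binders: `Thm37Hypotheses`, a base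
point sequence `P₀`, (hcoin), and the level data `χG`/`ab`/(hK)/(hsep) producing (hcrit)
(`thetaRay_hcrit_of_characters`). NEGATIVE-MODULO form. [cite: MochizukiSemiAnbd2006, Thm 3.7(iv) p.41] -/
theorem thetaRay_not_maximalCompactIffVerticialAt_of_characters (h37 : (thetaRay G E up low).Thm37Hypotheses)
    (P₀ : ((thetaRay G E up low).galoisLevelData h37.toProp36Hypotheses).PointSeq h37.isCountable (0 : ℕ))
    (e₀ : E) (hcoin : ∀ d : ℕ, ∃ N : ℕ, ∀ k, N ≤ k → (low (k + 1) e₀)⁻¹ * up e₀ ∈ charOpenCore G d)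
    (χG : ∀ n, G →ₜ* A n) (hχA : ∀ (n k : ℕ) (t : E), χG n (low k t) = χG n (up t))
    (ab : ∀ n, G →* V n)
    (hK : ∀ n : ℕ, ∃ j₀ : ℕ, ∀ j, j₀ ≤ j → ∀ (w : ℕ)
      (P : ((thetaRay G E up low).galoisLevelData h37.toProp36Hypotheses).PointSeq h37.isCountable w)
      (x : G), P.gal j x = 1 → ab n x = 1)
    (hsep : ∀ (n : ℕ) (t₁ t₂ : E), χG n (low (n + 1) t₁) = χG n (up e₀) → χG n (up t₂) = χG n (up e₀) →
      ab n (low (n + 1) t₁) ≠ ab n (up t₂)) :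
    ¬ MaximalCompactIffVerticialAt (thetaRay G E up low) :=
  thetaRay_not_maximalCompactIffVerticialAt_of_hcrit h37 P₀ e₀ hcoin
    (thetaRay_hcrit_of_characters h37.toProp36Hypotheses P₀ e₀ χG hχA ab hK hsep)

end Generic

/-! ### The countermodel `𝒢_θ(p, n)` -/

namespace ProfiniteSemiGraph

open Literature.AnabelianGeometry.SemiGraphs.FreeProPRankTwo

variable (p : ℕ) [hp : Fact p.Prime] (n : ℕ → ℕ)

/-- **[SemiAnbd] Thm 3.7 (iv) FAILS at `𝒢_θ(p, n)`** (`k ≤ n k`): the maximal compact subgroups of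
`π₁^temp(𝒢_θ)` (canonical chart) are NOT precisely the verticial subgroups — the escaping compact subgroup of
the (iii) refutation lies in a maximal compact subgroup (Zorn, finite-subgroup bound of Thm 3.7 (iv)'s own
level groups) which is contained in no verticial subgroup, hence is not verticial.  Script: abc-iut-L3-d4's
`thetaRayFreeProP_not_compactInVerticialAt` verbatim with the (iv) closer.
[cite: MochizukiSemiAnbd2006, Thm 3.7(iv) p.41] -/
theorem thetaRayFreeProP_not_maximalCompactIffVerticialAt (hn : ∀ k, k ≤ n k) :
    ¬ MaximalCompactIffVerticialAt (thetaRayFreeProP p n) := by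
  classical
  haveI : NeZero p := ⟨hp.out.ne_zero⟩
  -- `Thm37Hypotheses 𝒢_θ(p, n)` unconditionally (bricks R1–R5; the term of abc-iut-L3-d4's
  -- `thetaRayFreeProP_thm37Hypotheses'`, spelled out so that this file does not wait on that olean)
  have h37 : (thetaRayFreeProP p n).Thm37Hypotheses :=
    thetaRayFreeProP_thm37Hypotheses p n
      (thetaRayFreeProP_isGaloisCountable p (α p) (α_ofAdd_one p) (fun m => θHom p m)
        (fun m => (θ p m).bijective) n)
      (thetaRayFreeProP_isQuasiCoherent p (α p) (α_ofAdd_one p) (fun m => θHom p m)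
        (fun m => (θ p m).bijective) n)
      (thetaRayFreeProP_isTotallyElevated_concrete p n)
      (thetaRayFreeProP_isTotallyAloof_concrete p n)
      (thetaRayFreeProP_isTotallyEstranged_concrete p n)
  have h36 : (thetaRayFreeProP p n).Prop36Hypotheses := h37.toProp36Hypotheses
  -- a base point sequence over `v_0`
  obtain ⟨P₀⟩ := thetaRay_nonempty_pointSeq_zero (G := Grp p) (E := Multiplicative ℤ_[p]) (up := α p)
    (low := fun k => θα p (n k)) h36
  -- strict coherence (for abc-iut-L3-t6's level kernels)
  have hsc : (thetaRayFreeProP p n).IsStrictlyCoherent :=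
    thetaRayFreeProP_isStrictlyCoherent p (α p) (α_ofAdd_one p) (fun m => θHom p m)
      (fun m => (θ p m).bijective) n
  -- (hcoin): `(θ_{n(k+1)} a)⁻¹ a = b^{-p^{n(k+1)}} → 1` through the characteristic open cores
  have hcoin : ∀ d : ℕ, ∃ N : ℕ, ∀ k, N ≤ k →
      ((fun k => θα p (n k)) (k + 1) (ofAdd (1 : ℤ_[p])))⁻¹ * α p (ofAdd 1) ∈ charOpenCore (Grp p) d :=
    thetaRayOfTwists_hcoin (α := α p) (θ := fun m => θHom p m) (n := n) (ofAdd (1 : ℤ_[p])) (b := b p)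
      (p := p) (fun m => by rw [α_ofAdd_one, θHom_apply, θ_a]) hn
      (fun d => exists_pow_prime_pow_mem p _ (FreeProPRankTwo.isOpen_charOpenCore p d) (b p))
  -- the level data: characters `χaMod (e m)`, abelianisations `abMod (e m)`, `e m := n (m+1) + 1`
  refine thetaRay_not_maximalCompactIffVerticialAt_of_characters (G := Grp p) (E := Multiplicative ℤ_[p])
    (up := α p) (low := fun k => θα p (n k))
    (A := fun m => Multiplicative (ZMod (p ^ (n (m + 1) + 1))))
    (V := fun m => Multiplicative (ZMod (p ^ (n (m + 1) + 1)) × ZMod (p ^ (n (m + 1) + 1))))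
    h37 P₀ (ofAdd 1) hcoin (fun m => χaMod p (n (m + 1) + 1)) ?_
    (fun m => (abMod p (n (m + 1) + 1)).toMonoidHom) ?_ ?_
  · -- hχA: the characters are compatible with the gluings (`χaMod` is `θ`-invariant)
    intro m k t
    change χaMod p _ (θ p (n k) (α p t)) = χaMod p _ (α p t)
    rw [χaMod_θ]
  · -- hK: at deep levels the point stabilisers lie in the characteristic core `⊆ ker (abMod e)` (L3-t6)
    intro m
    obtain ⟨j₀, hj₀⟩ := (thetaRayFreeProP p n).exists_level_hK h36 hsc (p ^ (2 * (n (m + 1) + 1)))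
    exact ⟨j₀, fun j hj w P x hx =>
      hj₀ j hj w P (abMod p (n (m + 1) + 1)).toMonoidHom (charOpenCore_le_ker_abMod p _) x hx⟩
  · -- hsep: the model arithmetic `(u, p^{n_{m+1}} u) ≠ (u, 0)` in `(ℤ/p^e)²`, `n_{m+1} < e`
    intro m t₁ t₂ h₁ h₂
    exact abMod_θ_α_ne_abMod_α_of_lt p (Nat.lt_succ_self _) t₁ t₂ h₁ h₂

/-- **`¬ MaximalCompactIffVerticial`**: the cell's ∀-countable typing (named fact F-1750) of [SemiAnbd]
Thm 3.7 (iv) is FALSE — countermodel `𝒢_θ(p, k ↦ k + 1)` for any prime `p` (here `p = 2`).  The printed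
theorem for FINITE semi-graphs (`maximalCompactIffVerticialAt_of_compactInVerticialAt` with
`compactInVerticialAt_of_finiteGraph`) is unaffected. [cite: MochizukiSemiAnbd2006, Thm 3.7(iv) p.41] -/
theorem not_maximalCompactIffVerticial : ¬ MaximalCompactIffVerticial.{0} := fun h =>
  haveI : Fact (Nat.Prime 2) := ⟨Nat.prime_two⟩
  thetaRayFreeProP_not_maximalCompactIffVerticialAt 2 (fun k => k + 1) (fun k => Nat.le_succ k)
    (maximalCompactIffVerticial_iff_forall_at.mp h _)

end ProfiniteSemiGraph

end Literature.AnabelianGeometry.SemiGraphs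

end
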